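import Summits.HodgeConjecture.HodgeConjecture.Theses.SecondaryPeriods
import Summits.HodgeConjecture.HodgeConjecture.Theorems.SecondaryPeriodsLevelOneConiveauThreefoldsCurveCorrespondencesRankTwo
import Summits.HodgeConjecture.HodgeConjecture.Theorems.SecondaryPeriodsRiemannWeightOne

/-!
# Birth skeleton (BC3) of the crux `LevelOneConiveauThreefolds` (stmt-HodgeConjecture-10376),
# route `SecondaryPeriods` — line "curve correspondences" (Grothendieck's mechanism run FORWARD)

RESHAPE c3 (lead prover-line-stmt-HodgeConjecture-10376-c3-0, 2026-08-17): STUB 1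
`stub_levelOneSpanOfCurve` is LANDED (`Theorems/SecondaryPeriodsLevelOneConiveauThreefoldsStubLevelOneSpanOfCurve`,
p163078: Riemann's theorem in geometric form, the route's crux #6 `RiemannWeightOne`, was proved at
13:04Z as `riemannWeightOne_proof`, and the curve form follows by the landed reduction
`levelOneSpanOfCurve_of_riemannWeightOne`) — its `sorry` below is replaced by (the term of) the tree theorem
`Summit.HodgeConjecture.HodgeConjecture.Theorems.stub_levelOneSpanOfCurve`. ONE stub remains,
`stub_curveCorrespondenceAlgebraic`, and it is now kernel-EQUIVALENT to the crux with no hypothesis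
(`levelOneConiveauThreefolds_iff_curveCorrespondenceAlgebraic`, same file): GHC(3,1) for threefolds
IS the Hodge conjecture for the `(3,1)`-Künneth codimension-2 classes on the fourfolds `Y × C`.

Skeleton registrar `skel-stmt-HodgeConjecture-10376` (planner one-shot, 2026-08-17). The crux is
Grothendieck's amended GHC(3,1) for smooth projective threefolds `Y/ℂ`: a rationally spanned
sub-Hodge structure `W = span s ⊆ H³(Y(ℂ); ℂ)` of Hodge coniveau `≥ 1` (types `(2,1)`, `(1,2)` only)
lies in `N¹H³(Y) = supportedClasses Y 3 1`. It is concluded BY NAME (the route decl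
`Summit.HodgeConjecture.HodgeConjecture.Theses.SecondaryPeriods.LevelOneConiveauThreefolds`).

## The line (two registered stubs + proved glue)

The only general mechanism known for putting a level-one Hodge structure on a divisor is
Grothendieck's (Topology 8 (1969) p. 301; Abdulali in Kerr–Pearlstein 2016, Ch. 11, Prop. 3.2): realise
`W` as the image of `H¹` of a CURVE under a correspondence, make the correspondence ALGEBRAIC — a
codimension-2 cycle on the FOURFOLD `Y × C` — and read off the support of its action. Run forward
(no Hodge conjecture assumed), the two inputs are exactly the two stubs:

* `stub_levelOneSpanOfCurve` — WEIGHT-ONE REALISATION BY A CURVE: `W = φ(H¹(C(ℂ); ℂ))` for a smooth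
  projective curve `C`, a Hodge model `B` of `C` and a `ℂ`-linear `φ : H¹(C(ℂ)) → H³(Y(ℂ))` sending
  rational classes to rational classes and type `(p,q)` to type `(p+1,q+1)` (a morphism of Hodge
  structures `H¹(C)(−1) → H³(Y)` onto `W`). TRUE IN PRINT (Riemann: `W(1) = H¹(A)`, `A` an abelian
  variety; `A` is a quotient of a Jacobian `J(C)`; Voisin I Lemma 7.26 splits): it is the conclusion
  of the LANDED tree theorem `exists_curve_of_levelOne_threefold_span`, whose two inputs are the named
  fact `weightOne_polarizable_eq_range_of_curve` (Riemann's theorem, curve form — unproved in the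
  tree) and Hodge–Riemann polarisability (LANDED, `smoothProjective_hodgeStructure_isPolarizable_holds`);
  `levelOneSpanOfCurve_of_riemannCurve` below PROVES `weightOne_polarizable_eq_range_of_curve → stub`.
  Size XL (abelian varieties / Jacobians as `SchemeOver ℂ` with `H¹` comparison: not in the tree).
* `stub_curveCorrespondenceAlgebraic` — THE OPEN HEART: every such `φ : H¹(C(ℂ)) → H³(Y(ℂ))`
  (rational, type `(1,1)`; `C` a smooth projective curve, `Y` a smooth projective threefold) is the
  action `γ_* = pr_{Y*}(pr_C^*(–) ∪ γ)` (`corrAction`) of an ALGEBRAIC codimension-2 class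
  `γ ∈ N²H⁴((Y ⊗ C)(ℂ)) = algebraicClasses (Y ⊗ C) 2` — the Hodge conjecture for the
  `H³(Y) ⊗ H¹(C)`-Künneth classes of CODIMENSION 2 on the FOURFOLD `Y × C` (by Voisin I Lemma 11.41,
  LANDED as `exists_rational_hodgeClass_corrAction_eq_smul`, `φ = t⁻¹ γ_*` for a RATIONAL HODGE class
  `γ` of type `(2,2)`, so `curveCorrespondenceAlgebraic_of_hodgeConjecture` below PROVES
  `HodgeConjecture → stub`). OPEN; known when `CH₀(Y)` is supported on a surface `S` (e.g. `Y`
  uniruled): then `CH₀(Y × C)` is supported on the threefold `S × C` and the Hodge conjecture holds for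
  degree-4 classes on the fourfold `Y × C` (Bloch–Srinivas 1983 = Voisin II Prop. 10.26; Conte–Murre
  1978 for fourfolds covered by rational curves) — exactly the known cases of GHC(3,1) recorded on the
  crux; at the route's three rational rank-2 attractors (`C = E` the attractor
  elliptic curve, `φ : H¹(E)(−1) ≅ V`) it is LITERALLY "HC for `Y × E`", the kill switch named in the
  crux docstring. Conversely GHC(3,1) gives it back modulo classical theorems not in the tree
  (semisimplicity of polarisable Hodge structures lifts `φ` through the Gysin map of a desingularised
  supporting surface `S̃ → Y`; Lefschetz (1,1) on `C × S̃` makes the lift a divisorial correspondence),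
  so the stub is crux-strength in truth value but NOT by any cheap Lean step (BC3 probes fail, NOTES).
* `LevelOneConiveauThreefolds_of` (NO `sorry`; hypotheses = the two stubs BY NAME, `Registered.stub_*`):
  `W = range φ = range γ_*`; `pr_C^* c ∪ γ ∈ N²H⁵(Y ⊗ C)` (cup product with a class dying off `Z` dies
  off `Z`: `cupProduct_mem_supportedClasses_of_right`, naturality of `∪`); the Gysin morphism of
  `pr_Y : Y ⊗ C → Y` (relative dimension 1) lowers the codimension of supports by one
  (`gysinMap_mem_supportedClasses_of_isSmoothProjective`, LANDED), so `γ_* c ∈ N¹H³(Y)`.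

Honours the refuters' crux-attack (CRUX-ATTACK.md on the item: each of rational / sub-Hodge /
level-one is load-bearing): all three hypotheses are consumed by `stub_levelOneSpanOfCurve` (no curve
realisation without them — quintic `H^{3,0} ≠ 0`, Grothendieck's `E_τ³`). Disproof used: none on file
(`ledger crux ls stmt-HodgeConjecture-10376`: no workfiles before this one; no `Negative/` lemma).
SAME SEAM as the sibling birth skeleton of the negative crux `ConiveauOneFailure`
(`Cruxes/ConiveauOneFailure/Lines/birth.lean`, registered 2026-08-17T02:42Z): there GHC(3,1) is
transferred to "carried by an algebraic curve correspondence" (`CarriedByCurveCorrespondence`, over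
`IsAlgebraicCorrespondence`) and the bet is an attractor plane carried by none; here the positive side
asks for the algebraic class itself (`corrAction μ … γ = φ`, `γ ∈ algebraicClasses (Y ⊗ C) 2`, which
gives `IsAlgebraicCorrespondence 3 1 Y C φ` by `isAlgebraicCorrespondence_corrAction`). The two-sided
test is thus cut, on both sides, at codimension-2 cycles on the fourfolds `Y × C`.

BC3 probes (planner folder `bc/stub_*_probe*.lean`, 2026-08-17; all FAIL as required): for each stub `S`,
`example : S → LevelOneConiveauThreefolds` and `example : S → HodgeConjecture` by
`first | exact? | simpa | aesop` (400 000 heartbeats) do not elaborate — `CurveCorrespondenceAlgebraic`: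
`exact?` "could not close the goal", `simpa` "assumption failed", `aesop` "failed after exhaustive
search" (both targets); `LevelOneSpanOfCurve`: `simpa` fails, `aesop` fails after exhaustive search,
`exact?` exhausts 400 000 and 4 000 000 heartbeats on the 7-binder hypothesis without a proof, and in
the POINTWISE form (crux data fixed, the stub's `∃` in context, goal `span s ≤ supportedClasses Y 3 1`,
resp. `HodgeConjectureFor 3 Y`) terminates with "could not close the goal"; controls: `exact?` on the
bare goals `LevelOneConiveauThreefolds` / `HodgeConjecture` — "could not close the goal".
-/

noncomputable section

open CategoryTheory AlgebraicGeometry MonoidalCategory CartesianMonoidalCategory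
open Literature.AlgebraicTopology.SingularHomology
open Literature.AlgebraicGeometry Literature.AlgebraicGeometry.HodgeTheory

namespace Summit.HodgeConjecture.HodgeConjecture.Cruxes.LevelOneConiveauThreefolds.Birth

/-! ## §1 The two statements of the line -/

/-- **Statement 1 — weight-one realisation of a level-one sub-Hodge structure of `H³` of a threefold
by a CURVE.** For `Y` smooth projective of dimension 3, a Hodge model `A`, and a finite set `s` of
rational classes of `H³(Y(ℂ); ℂ)` whose span `W` is sub-Hodge (`W = ⊕ W ∩ H^{p,q}`) and of Hodge
coniveau `≥ 1` (`W ⊆ H^{2,1} ⊕ H^{1,2}`) — the crux's hypotheses verbatim — there are a smooth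
projective curve `C`, a Hodge model `B` of `C` and `φ : H¹(C(ℂ); ℂ) →ₗ H³(Y(ℂ); ℂ)` preserving rational
classes, of type `(1,1)`, with `range φ = W`. The conclusion of `exists_curve_of_levelOne_threefold_span`
(Riemann's theorem in curve form + Hodge–Riemann polarisability). [VoisinHodgeI2002 §7.2.2, §7.3.1
Lemma 7.26; KerrPearlstein2016 Ch. 11 p. 288; LangeBirkenhake1992 Thm. 2.1.18, Prop. 4.5.8] -/
def LevelOneSpanOfCurve : Prop :=
  ∀ ⦃Y : Motives.SchemeOver ℂ⦄, Motives.IsSmoothProjective 3 Y → ∀ (A : HodgeModel 3 Y)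
    (s : Finset (complexBetti Y 3)), (∀ c ∈ s, IsRationalClass c) →
    (Submodule.span ℂ (↑s : Set (complexBetti Y 3))).map (A.pullback 3).hom =
      (⨆ (p : ℕ) (q : ℕ) (_ : p + q = 3),
        (Submodule.span ℂ (↑s : Set (complexBetti Y 3))).map (A.pullback 3).hom ⊓ A.hodgePQ 3 p q) →
    (Submodule.span ℂ (↑s : Set (complexBetti Y 3))).map (A.pullback 3).hom ≤
      (⨆ (p : ℕ) (q : ℕ) (_ : p + q = 3) (_ : 1 ≤ p) (_ : 1 ≤ q), A.hodgePQ 3 p q) →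
    ∃ (C : Motives.SchemeOver ℂ) (_ : Motives.IsSmoothProjective 1 C) (B : HodgeModel 1 C)
      (φ : complexBetti C 1 →ₗ[ℂ] complexBetti Y 3),
      (∀ c, IsRationalClass c → IsRationalClass (φ c)) ∧
      (∀ (p q : ℕ), p + q = 1 → ∀ c, B.pullback 1 c ∈ B.hodgePQ 1 p q →
        A.pullback 3 (φ c) ∈ A.hodgePQ 3 (p + 1) (q + 1)) ∧
      LinearMap.range φ = Submodule.span ℂ (↑s : Set (complexBetti Y 3))

/-- **Statement 2 — level-one curve correspondences into `H³` of a threefold are algebraic** (the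
Hodge conjecture for the `(3,1)`-Künneth classes of codimension 2 on the fourfold `Y × C`). For `Y`
smooth projective of dimension 3, `C` a smooth projective curve, Hodge models `A`, `B`, and
`φ : H¹(C(ℂ); ℂ) →ₗ H³(Y(ℂ); ℂ)` preserving rational classes and of type `(1,1)`, and every orientation
family `μ`: `φ = γ_*` (`corrAction μ`: `c ↦ pr_{Y*}(pr_C^* c ∪ γ)`, degrees `1 + 2·2 = 3 + 2·1`) for
some ALGEBRAIC class `γ ∈ algebraicClasses (Y ⊗ C) 2 = N²H⁴((Y ⊗ C)(ℂ); ℂ)` (all `μ` at once: the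
action changes by a non-zero scalar with `μ`, `corrAction_eq_smul_of_orientationFamily`, and algebraic
classes form a `ℂ`-subspace). OPEN (⇐ HC, `curveCorrespondenceAlgebraic_of_hodgeConjecture`; known when
`CH₀(Y)` is supported on a surface, e.g. `Y` uniruled: HC in degree 4 on `Y × C`, Voisin II Prop. 10.26).
[GrothendieckTopology1969 p. 301; KerrPearlstein2016 Ch. 11 Prop. 3.2; VoisinHodgeI2002 Lemma 11.41;
VoisinHodgeII2003 Prop. 10.26; BlochSrinivas1983; ConteMurre1978; CandelasEtAl2020 §6;
BonischEtAl2024 §3.3] -/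
def CurveCorrespondenceAlgebraic : Prop :=
  ∀ ⦃Y C : Motives.SchemeOver ℂ⦄ (hY : Motives.IsSmoothProjective 3 Y)
    (hC : Motives.IsSmoothProjective 1 C) (A : HodgeModel 3 Y) (B : HodgeModel 1 C)
    (φ : complexBetti C 1 →ₗ[ℂ] complexBetti Y 3),
    (∀ c, IsRationalClass c → IsRationalClass (φ c)) →
    (∀ (p q : ℕ), p + q = 1 → ∀ c, B.pullback 1 c ∈ B.hodgePQ 1 p q →
      A.pullback 3 (φ c) ∈ A.hodgePQ 3 (p + 1) (q + 1)) →
    ∀ (μ : OrientationFamily),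
      ∃ γ ∈ algebraicClasses (Y ⊗ C) 2,
        corrAction μ hY hC (show 1 + 2 * 2 = 3 + 2 * 1 from rfl) γ = φ

/-! ## §2 The registered stubs (`sorry` lives only in `stub_curveCorrespondenceAlgebraic`; STUB 1 is closed)

Each restates its §1 statement VERBATIM (so that a stub worker lands it as stated and
`propose --supports stmt-HodgeConjecture-10376` matches it by name + signature); `*_holds` checks the
restatement is definitionally the named statement. -/

/-- **STUB 1 · `stub_levelOneSpanOfCurve`** — CLOSED (c3): the tree theorem
`Summit.HodgeConjecture.HodgeConjecture.Theorems.stub_levelOneSpanOfCurve` (p163078). See `LevelOneSpanOfCurve`. -/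
theorem stub_levelOneSpanOfCurve :
    ∀ ⦃Y : Motives.SchemeOver ℂ⦄, Motives.IsSmoothProjective 3 Y → ∀ (A : HodgeModel 3 Y)
      (s : Finset (complexBetti Y 3)), (∀ c ∈ s, IsRationalClass c) →
      (Submodule.span ℂ (↑s : Set (complexBetti Y 3))).map (A.pullback 3).hom =
        (⨆ (p : ℕ) (q : ℕ) (_ : p + q = 3),
          (Submodule.span ℂ (↑s : Set (complexBetti Y 3))).map (A.pullback 3).hom ⊓ A.hodgePQ 3 p q) →
      (Submodule.span ℂ (↑s : Set (complexBetti Y 3))).map (A.pullback 3).hom ≤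
        (⨆ (p : ℕ) (q : ℕ) (_ : p + q = 3) (_ : 1 ≤ p) (_ : 1 ≤ q), A.hodgePQ 3 p q) →
      ∃ (C : Motives.SchemeOver ℂ) (_ : Motives.IsSmoothProjective 1 C) (B : HodgeModel 1 C)
        (φ : complexBetti C 1 →ₗ[ℂ] complexBetti Y 3),
        (∀ c, IsRationalClass c → IsRationalClass (φ c)) ∧
        (∀ (p q : ℕ), p + q = 1 → ∀ c, B.pullback 1 c ∈ B.hodgePQ 1 p q →
          A.pullback 3 (φ c) ∈ A.hodgePQ 3 (p + 1) (q + 1)) ∧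
        LinearMap.range φ = Submodule.span ℂ (↑s : Set (complexBetti Y 3)) :=
  -- LANDED (c3, p163078) as `Summit.HodgeConjecture.HodgeConjecture.Theorems.stub_levelOneSpanOfCurve`;
  -- the same term is inlined here (Riemann in geometric form `riemannWeightOne_proof` + curve
  -- sections + semisimplicity), so that the skeleton elaborates against already-built modules.
  fun _ hY A s hs hsub hlev ↦
    Summit.HodgeConjecture.HodgeConjecture.Theorems.levelOneSpanOfCurve_of_riemannWeightOne
      Summit.HodgeConjecture.HodgeConjecture.Theorems.riemannWeightOne_proof hY A s hs hsub hlev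

/-- **STUB 2 · `stub_curveCorrespondenceAlgebraic`** (OPEN; the heart, HARDEST) — see
`CurveCorrespondenceAlgebraic`. -/
theorem stub_curveCorrespondenceAlgebraic :
    ∀ ⦃Y C : Motives.SchemeOver ℂ⦄ (hY : Motives.IsSmoothProjective 3 Y)
      (hC : Motives.IsSmoothProjective 1 C) (A : HodgeModel 3 Y) (B : HodgeModel 1 C)
      (φ : complexBetti C 1 →ₗ[ℂ] complexBetti Y 3),
      (∀ c, IsRationalClass c → IsRationalClass (φ c)) →
      (∀ (p q : ℕ), p + q = 1 → ∀ c, B.pullback 1 c ∈ B.hodgePQ 1 p q →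
        A.pullback 3 (φ c) ∈ A.hodgePQ 3 (p + 1) (q + 1)) →
      ∀ (μ : OrientationFamily),
        ∃ γ ∈ algebraicClasses (Y ⊗ C) 2,
          corrAction μ hY hC (show 1 + 2 * 2 = 3 + 2 * 1 from rfl) γ = φ := by
  sorry

/-! ### Consistency: each named statement IS its registered stub (definitionally) -/

theorem levelOneSpanOfCurve_holds : LevelOneSpanOfCurve := stub_levelOneSpanOfCurve
theorem curveCorrespondenceAlgebraic_holds : CurveCorrespondenceAlgebraic :=
  stub_curveCorrespondenceAlgebraic

/-! ### Name-keyed aliases of the statements (the hypotheses of the composition; admissible BY NAME) -/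
namespace Registered

/-- Alias of `LevelOneSpanOfCurve` keyed by the registered stub name. -/
abbrev stub_levelOneSpanOfCurve : Prop := LevelOneSpanOfCurve
/-- Alias of `CurveCorrespondenceAlgebraic` keyed by the registered stub name. -/
abbrev stub_curveCorrespondenceAlgebraic : Prop := CurveCorrespondenceAlgebraic

end Registered

/-! ## §3 Proved glue and calibrations (no `sorry` from here on) -/

/-- **Cup product with a supported class is supported** (naturality of `∪` under restriction to
`(X ∖ Z)(ℂ)`): `x ∪ γ ∈ Nʳ Hᵏ` whenever `γ ∈ Nʳ H^q`. [GrothendieckTopology1969 §1] -/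
theorem cupProduct_mem_supportedClasses_of_right {X : Motives.SchemeOver ℂ} {p q k : ℕ}
    (hpq : p + q = k) {r : ℕ} (x : complexBetti X p) {γ : complexBetti X q}
    (hγ : γ ∈ supportedClasses X q r) :
    cupProduct hpq x γ ∈ supportedClasses X k r := by
  suffices h : supportedClasses X q r ≤ (supportedClasses X k r).comap (cupProduct hpq x) from h hγ
  refine iSup_le fun Z ↦ iSup_le fun hZ ↦ iSup_le fun hr ↦ fun γ' hγ' ↦ ?_
  rw [Submodule.mem_comap]
  refine mem_supportedClasses_of_restrictCompl_eq_zero hZ hr ?_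
  rw [LinearMap.mem_ker] at hγ'
  change singularCohomology.map ℂ ℂ _ k (cupProduct hpq x γ') = 0
  rw [cupProduct_map]
  change cupProduct hpq _ (complexBetti.restrictCompl X Z q γ') = 0
  rw [hγ', map_zero]

/-- **Calibration of stub 1**: it follows from Riemann's theorem in curve form (the tree's named fact
`weightOne_polarizable_eq_range_of_curve`) — by the LANDED `exists_curve_of_levelOne_threefold_span`
fed with the LANDED Hodge–Riemann polarisability. So stub 1 is true in print and closes the day that
named fact is discharged. [KerrPearlstein2016 Ch. 11 p. 288; VoisinHodgeI2002 §7.3.1] -/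
theorem levelOneSpanOfCurve_of_riemannCurve (h0 : weightOne_polarizable_eq_range_of_curve) :
    LevelOneSpanOfCurve :=
  fun _ hY A s hs hsub hlev ↦
    exists_curve_of_levelOne_threefold_span h0 smoothProjective_hodgeStructure_isPolarizable_holds
      hY A s hs hsub hlev

/-- **Calibration of stub 2**: it follows from the Hodge conjecture (Voisin I Lemma 11.41 on the
tree's carriers, LANDED as `exists_rational_hodgeClass_corrAction_eq_smul`: `φ = t⁻¹ • γ_*` for a
rational Hodge class `γ` of type `(2,2)` on the fourfold `Y ⊗ C`; HC makes `γ` algebraic). So the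
stub is a GENUINE SPECIAL CASE of the summit (not more), namely HC for level-one curve
correspondences. [VoisinHodgeI2002 Lemma 11.41; GrothendieckTopology1969 p. 301] -/
theorem curveCorrespondenceAlgebraic_of_hodgeConjecture (hHC : _root_.HodgeConjecture) :
    CurveCorrespondenceAlgebraic := by
  intro Y C hY hC A B φ hφ hφH μ
  obtain ⟨γ, hγ, hγH, t, ht, heq⟩ :=
    exists_rational_hodgeClass_corrAction_eq_smul hY hC A B (show 1 + 2 * 2 = 3 + 2 * 1 from rfl)
      (show 1 + 1 = 2 from rfl) φ hφ hφH μ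
  have halg : γ ∈ algebraicClasses (Y ⊗ C) 2 :=
    (hHC (Motives.IsSmoothProjective.tensor_holds hY hC)).2 2 γ hγ hγH
  refine ⟨t⁻¹ • γ, Submodule.smul_mem _ _ halg, ?_⟩
  rw [map_smul, heq, smul_smul, inv_mul_cancel₀ ht, one_smul]

/-! ## §4 The composition: the stubs imply the crux, BY NAME (kernel-checked; no `sorry`) -/

/-- **`LevelOneConiveauThreefolds_of`** — the glue of the line. Given the crux's data
`(Y, A, s)` with `W = span s` rational, sub-Hodge and of Hodge coniveau `≥ 1`: stub 1 writes
`W = φ(H¹(C(ℂ)))` for a smooth projective curve `C` and a rational type-`(1,1)` map `φ`; stub 2 writes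
`φ = γ_*` for an algebraic codimension-2 class `γ` on the fourfold `Y ⊗ C` (any orientation family
`μ`; every one has Poincaré duality, `OrientationFamily.hasPoincareDuality`); then for `c ∈ H¹(C(ℂ))`,
`γ_* c = pr_{Y*}(pr_C^* c ∪ γ)` with `pr_C^* c ∪ γ ∈ N²H⁵((Y ⊗ C)(ℂ))`
(`cupProduct_mem_supportedClasses_of_right`) and the Gysin morphism of `pr_Y` (relative dimension 1)
lands it in `N¹H³(Y)` (`gysinMap_mem_supportedClasses_of_isSmoothProjective`, `1 + 4 ≤ 3 + 2`).
Hypothesis (since c3): the ONE open registered stub `Registered.stub_curveCorrespondenceAlgebraic` BY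
NAME (STUB 1 is proved: `levelOneSpanOfCurve_holds`); conclusion: the route decl BY NAME; axioms
`propext`, `Classical.choice`, `Quot.sound`. -/
theorem LevelOneConiveauThreefolds_of (h2 : Registered.stub_curveCorrespondenceAlgebraic) :
    Summit.HodgeConjecture.HodgeConjecture.Theses.SecondaryPeriods.LevelOneConiveauThreefolds := by
  -- STUB 1 is closed (c3): the proved `levelOneSpanOfCurve_holds` replaces the former hypothesis `h1`
  have h1 : Registered.stub_levelOneSpanOfCurve := levelOneSpanOfCurve_holds
  intro Y hY A s hs hsub hlev
  obtain ⟨C, hC, B, φ, hφ, hφH, hrange⟩ := h1 hY A s hs hsub hlev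
  -- an orientation family (the complex points of a smooth projective variety are orientable)
  obtain ⟨μ⟩ : Nonempty OrientationFamily :=
    ⟨fun _ _ h ↦ Classical.choice (Motives.ComplexPoints.isOrientableOver ℂ h)⟩
  obtain ⟨γ, hγ, hγφ⟩ := h2 hY hC A B φ hφ hφH μ
  rw [← hrange, ← hγφ]
  rintro _ ⟨c, rfl⟩
  -- `γ_* c = pr_{Y*}(pr_C^* c ∪ γ)`, the Gysin morphism being the topological one through `H₃`
  rw [corrAction_apply,
    complexGysin_eq_gysinMap (Motives.IsSmoothProjective.tensor_holds hY hC) hY (fst Y C)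
      (corrAction_degree 3 (show 1 + 2 * 2 = 3 + 2 * 1 from rfl)) (q := 3) (by omega) (by omega)]
  exact gysinMap_mem_supportedClasses_of_isSmoothProjective
    (Motives.IsSmoothProjective.tensor_holds hY hC) hY (μ _) (μ hY)
    (OrientationFamily.hasPoincareDuality μ hY) (fst Y C) _ _ (show 1 + (3 + 1) ≤ 3 + 2 by omega)
    (cupProduct_mem_supportedClasses_of_right rfl (complexBetti.map (snd Y C) 1 c) hγ)

/-- Wiring check: the registered (sorried) stubs feed the composition as stated. -/
example : Summit.HodgeConjecture.HodgeConjecture.Theses.SecondaryPeriods.LevelOneConiveauThreefolds :=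
  LevelOneConiveauThreefolds_of stub_curveCorrespondenceAlgebraic

end Summit.HodgeConjecture.HodgeConjecture.Cruxes.LevelOneConiveauThreefolds.Birth

end
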